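import Literature.NumberTheory.LFunctions.WeilMarkovQuadratic
import Literature.NumberTheory.LFunctions.WeilArchimedeanMoments
import Literature.NumberTheory.LFunctions.WeilMellinInversion
import Literature.NumberTheory.LFunctions.WeilArchimedeanPositivityProofs
import Literature.NumberTheory.LFunctions.RiemannSiegel
import HarnessLib

/-!
# Weil's quadratic functional in spectral density form (`stub_densityForm`)

Route `RiemannHypothesis/SpectralTrace`, crux `WindowStep` (stmt-RiemannHypothesis-14659,
`∀ n ≥ 2, Trace(log n) → Trace(log (n+1))`), line `Sketch` (skeleton
`Summit.RiemannHypothesis.RiemannHypothesis.Cruxes.WindowStep.Sketch`, composition `WindowStep_of`),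
stub `stub_densityForm`.

**What is proved.** For a Weil test `g` (`IsWeilTest g`) supported in `[-a, a]`, with
`ĝ = weilMellin g`, `P = weilPoleForm`, `θ' = riemannSiegelThetaDeriv`
(`θ'(t) = Re ψ(1/4 + it/2)/2 − (log π)/2`) and `Λ` the von Mangoldt function,

  `Re Q(g) = P(g) + (1/π) (∫ |ĝ(1/2+it)|² θ'(t) dt
                − Σ_{m ∈ weilPrimeIndex a} Λ(m) m^{-1/2} ∫ |ĝ(1/2+it)|² cos(t log m) dt)`,

i.e. Yoshida's analytic form (1992, (2.1)) / Bombieri's explicit formula (2000, Thm 2) for the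
kernel `k = g ⋆ g̃`, written entirely on the critical line, primes included
(`stub_densityForm`, namespace
`Summit.RiemannHypothesis.RiemannHypothesis.Theorems.SpectralTraceWindowStep`).

**Ingredients (all proved tree facts).**
* `Re Q(g) = P(g) + Q₀(g)` (`weilQuadratic_re_eq_weilPoleForm_add`) and
  `Q₀(g) = Re(−prime(k) + arch(k))`, `k = g ⋆ g̃` (`weilMarkovQuadratic_eq_re`).
* Archimedean term (`stub_densityForm_arch`): `arch(k) = (1/2π)·weilArchIntegral k − k(0) log π`
  with `weilArchIntegral k = ∫ |ĝ(1/2+it)|² Re ψ(1/4+it/2) dt`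
  (`weilArchIntegral_weilConv_weilReflect`), `k(0) = ‖g‖₂²` (`weilConv_weilReflect_apply_zero`)
  and Plancherel `∫ |ĝ(1/2+it)|² dt = 2π ‖g‖₂²` (`integral_norm_sq_weilMellin_half_line`), so that
  `Re arch(k) = (1/2π) ∫ |ĝ|² (Re ψ − log π) = (1/π) ∫ |ĝ|² θ'`.
* Prime term (`stub_densityForm_prime`): the `tsum` defining `weilPrimeTerm k` is the finite sum
  over `weilPrimeIndex a` (`k(±log n) = 0` once `log n ≥ 2a`,
  `weilConv_weilReflect_eq_zero_of_le_abs`, `mem_weilPrimeIndex`), and by Mellin inversion on the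
  critical line (`weilMellin_inversion` for `k`, a Weil test by `IsWeilTest.weilConv`,
  `IsWeilTest.weilReflect`, with `k̂(1/2+it) = |ĝ(1/2+it)|²`, `weilMellin_weilConv_weilReflect_half`)
  `k(x) + k(−x) = (1/π) ∫ |ĝ(1/2+it)|² cos(t x) dt` (`stub_densityForm_kernel`, the pattern of
  `weilConv_weilReflect_log_two_add` at a general point `x`).

References: H. Yoshida, *On Hermitian forms attached to zeta functions*, Adv. Stud. Pure Math. 21
(1992), §2 eq. (2.1); E. Bombieri, *Remarks on Weil's quadratic functional in the theory of prime
numbers I*, Rend. Mat. Acc. Lincei (9) 11 (2000), Thm 2 and §2 (inverse Mellin transform).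
-/

-- single-problem summit: the tree namespace `Summit.RiemannHypothesis.RiemannHypothesis.…` repeats the name
set_option linter.dupNamespace false

noncomputable section

open Complex MeasureTheory Set Filter
open scoped Real

namespace Summit.RiemannHypothesis.RiemannHypothesis.Theorems.SpectralTraceWindowStep

open Literature.NumberTheory.LFunctions

variable {g : ℝ → ℂ}

/-! ## Mellin inversion on the critical line for the kernel `k = g ⋆ g̃` -/

/-- Integrability of `y ↦ |ĝ(1/2+iy)|² e^{−iyx}` (the transform `k̂(1/2+iy) = |ĝ(1/2+iy)|²` of the
Weil test `k = g ⋆ g̃` is integrable on the critical line, `integrable_weilMellin_vertical_mul`).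
[folklore] -/
theorem stub_densityForm_integrable (hg : IsWeilTest g) (x : ℝ) :
    Integrable fun y : ℝ ↦
      ((‖weilMellin g (1 / 2 + y * I)‖ ^ 2 : ℝ) : ℂ) * cexp (-(y * I) * (x : ℂ)) := by
  have hk : IsWeilTest (weilConv g (weilReflect g)) := hg.weilConv hg.weilReflect
  have hb : ∀ y : ℝ, ‖cexp (-(y * I) * (x : ℂ))‖ ≤ 1 := fun y ↦ by
    rw [show -(y * I : ℂ) * (x : ℂ) = ((-(y * x) : ℝ) : ℂ) * I by push_cast; ring,
      Complex.norm_exp_ofReal_mul_I]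
  have hi : Integrable fun y : ℝ ↦
      weilMellin (weilConv g (weilReflect g)) ((1 / 2 : ℝ) + y * I) * cexp (-(y * I) * (x : ℂ)) :=
    integrable_weilMellin_vertical_mul hk (1 / 2) (by fun_prop) hb
  refine hi.congr (Eventually.of_forall fun y ↦ ?_)
  have hy : ((1 / 2 : ℝ) : ℂ) + y * I = 1 / 2 + y * I := by push_cast; ring
  simp only [hy, weilMellin_weilConv_weilReflect_half hg y]

/-- Mellin inversion at `c = 1/2` for `k = g ⋆ g̃`:
`2π k(x) = ∫ |ĝ(1/2+iy)|² e^{−iyx} dy` (Bombieri 2000 §2, `weilMellin_inversion`, with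
`k̂(1/2+iy) = |ĝ(1/2+iy)|²`). [folklore] -/
theorem stub_densityForm_inversion (hg : IsWeilTest g) (x : ℝ) :
    2 * π * weilConv g (weilReflect g) x =
      ∫ y : ℝ, ((‖weilMellin g (1 / 2 + y * I)‖ ^ 2 : ℝ) : ℂ) * cexp (-(y * I) * (x : ℂ)) := by
  have hk : IsWeilTest (weilConv g (weilReflect g)) := hg.weilConv hg.weilReflect
  have h := weilMellin_inversion hk (1 / 2) x
  have e0 : ((1 / 2 : ℝ) : ℂ) - 1 / 2 = 0 := by push_cast; ring
  simp only [e0, zero_mul, Complex.exp_zero, mul_one] at h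
  rw [← h]
  congr 1 with y
  have hy : ((1 / 2 : ℝ) : ℂ) + y * I = 1 / 2 + y * I := by push_cast; ring
  rw [hy, weilMellin_weilConv_weilReflect_half hg y]

/-- **The kernel on the critical line.** For a Weil test `g` and `k = g ⋆ g̃`,
`k(x) + k(−x) = (1/π) ∫ |ĝ(1/2+it)|² cos(t x) dt` (`e^{−itx} + e^{itx} = 2 cos(tx)`; the pattern of
`weilConv_weilReflect_log_two_add` at a general point `x`). [folklore] -/
theorem stub_densityForm_kernel (hg : IsWeilTest g) (x : ℝ) :
    weilConv g (weilReflect g) x + weilConv g (weilReflect g) (-x) =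
      ((1 / π * ∫ t : ℝ, ‖weilMellin g (1 / 2 + t * I)‖ ^ 2 * Real.cos (t * x) : ℝ) : ℂ) := by
  have hpi : (2 * π : ℂ) ≠ 0 := by
    have : (0 : ℝ) < 2 * π := by positivity
    exact_mod_cast this.ne'
  have hsum : 2 * π * (weilConv g (weilReflect g) x + weilConv g (weilReflect g) (-x)) =
      ((∫ t : ℝ, ‖weilMellin g (1 / 2 + t * I)‖ ^ 2 * (2 * Real.cos (t * x)) : ℝ) : ℂ) := by
    rw [mul_add, stub_densityForm_inversion hg x, stub_densityForm_inversion hg (-x),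
      ← integral_add (stub_densityForm_integrable hg x) (stub_densityForm_integrable hg (-x)),
      ← integral_complex_ofReal]
    congr 1 with t
    have hcos : cexp (-(t * I) * (x : ℂ)) + cexp (-(t * I) * ((-x : ℝ) : ℂ)) =
        ((2 * Real.cos (t * x) : ℝ) : ℂ) := by
      have e1 : -(t * I : ℂ) * (x : ℂ) = -((t * x : ℝ) : ℂ) * I := by push_cast; ring
      have e2 : -(t * I : ℂ) * ((-x : ℝ) : ℂ) = ((t * x : ℝ) : ℂ) * I := by push_cast; ring
      rw [e1, e2, add_comm, ← Complex.two_cos]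
      push_cast
      ring
    rw [← mul_add, hcos]
    push_cast
    ring
  apply mul_left_cancel₀ hpi
  rw [hsum]
  have hpi' : (π : ℝ) ≠ 0 := Real.pi_ne_zero
  have hJ : (∫ t : ℝ, ‖weilMellin g (1 / 2 + t * I)‖ ^ 2 * (2 * Real.cos (t * x))) =
      2 * π * (1 / π * ∫ t : ℝ, ‖weilMellin g (1 / 2 + t * I)‖ ^ 2 * Real.cos (t * x)) := by
    rw [← integral_const_mul, ← integral_const_mul]
    congr 1 with t
    field_simp
  rw [hJ]
  simp only [Complex.ofReal_mul, Complex.ofReal_ofNat]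

/-! ## The prime term -/

/-- **The prime term of `k = g ⋆ g̃` on the critical line.** For a Weil test `g` supported in
`[-a, a]`, `Σₙ Λ(n) n^{-1/2} (k(log n) + k(−log n))
  = (1/π) Σ_{m ∈ weilPrimeIndex a} Λ(m) m^{-1/2} ∫ |ĝ(1/2+it)|² cos(t log m) dt`
(only `log n < 2a` contributes, `weilConv_weilReflect_eq_zero_of_le_abs`; then
`stub_densityForm_kernel`). [folklore] -/
theorem stub_densityForm_primeTerm (hg : IsWeilTest g) {a : ℝ} (hsupp : tsupport g ⊆ Icc (-a) a) :
    weilPrimeTerm (weilConv g (weilReflect g)) =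
      ((1 / π * ∑ m ∈ weilPrimeIndex a, (ArithmeticFunction.vonMangoldt m : ℝ) / Real.sqrt m *
        ∫ t : ℝ, ‖weilMellin g (1 / 2 + t * I)‖ ^ 2 * Real.cos (t * Real.log m) : ℝ) : ℂ) := by
  have hvan : ∀ n ∉ weilPrimeIndex a,
      ((ArithmeticFunction.vonMangoldt n : ℝ) : ℂ) / (Real.sqrt n : ℂ) *
        (weilConv g (weilReflect g) (Real.log n) + weilConv g (weilReflect g) (-Real.log n)) = 0 := by
    intro n hn
    rw [mem_weilPrimeIndex, not_lt] at hn
    have h0 : 0 ≤ Real.log n := Real.log_natCast_nonneg n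
    have h1 : weilConv g (weilReflect g) (Real.log n) = 0 :=
      weilConv_weilReflect_eq_zero_of_le_abs hg hsupp (by rwa [abs_of_nonneg h0])
    have h2 : weilConv g (weilReflect g) (-Real.log n) = 0 :=
      weilConv_weilReflect_eq_zero_of_le_abs hg hsupp (by rwa [abs_neg, abs_of_nonneg h0])
    rw [h1, h2, add_zero, mul_zero]
  unfold weilPrimeTerm
  rw [tsum_eq_sum hvan, Finset.mul_sum, Complex.ofReal_sum]
  refine Finset.sum_congr rfl fun n _ ↦ ?_
  rw [stub_densityForm_kernel hg (Real.log n)]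
  push_cast
  ring

/-- Real part of the prime term of `k = g ⋆ g̃`:
`Re prime(k) = (1/π) Σ_{m ∈ weilPrimeIndex a} Λ(m) m^{-1/2} ∫ |ĝ(1/2+it)|² cos(t log m) dt`. [folklore] -/
theorem stub_densityForm_prime (hg : IsWeilTest g) {a : ℝ} (hsupp : tsupport g ⊆ Icc (-a) a) :
    (weilPrimeTerm (weilConv g (weilReflect g))).re =
      1 / π * ∑ m ∈ weilPrimeIndex a, (ArithmeticFunction.vonMangoldt m : ℝ) / Real.sqrt m *
        ∫ t : ℝ, ‖weilMellin g (1 / 2 + t * I)‖ ^ 2 * Real.cos (t * Real.log m) := by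
  rw [stub_densityForm_primeTerm hg hsupp, Complex.ofReal_re]

/-! ## The archimedean term -/

/-- The scalar bookkeeping of the archimedean term:
`A/(2π) − N log π = (1/π)(A/2 − (log π)/2 · 2πN)`. [folklore] -/
theorem stub_densityForm_arch_alg (A N : ℝ) :
    1 / (2 * π) * A - N * Real.log π = 1 / π * (1 / 2 * A - Real.log π / 2 * (2 * π * N)) := by
  have hpi : (π : ℝ) ≠ 0 := Real.pi_ne_zero
  field_simp

/-- **The archimedean term of `k = g ⋆ g̃` through `θ'`.** For a Weil test `g`,
`Re arch(k) = (1/2π) ∫ |ĝ(1/2+it)|² Re ψ(1/4+it/2) dt − ‖g‖₂² log π = (1/π) ∫ |ĝ(1/2+it)|² θ'(t) dt`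
(`weilArchIntegral_weilConv_weilReflect`, `weilConv_weilReflect_apply_zero`, Plancherel
`integral_norm_sq_weilMellin_half_line`, `θ' = Re ψ(1/4+it/2)/2 − (log π)/2`). [folklore] -/
theorem stub_densityForm_arch (hg : IsWeilTest g) :
    (weilArchTerm (weilConv g (weilReflect g))).re =
      1 / π * ∫ t : ℝ, ‖weilMellin g (1 / 2 + t * I)‖ ^ 2 * riemannSiegelThetaDeriv t := by
  have hMD : Integrable fun t : ℝ ↦
      ‖weilMellin g (1 / 2 + t * I)‖ ^ 2 * (Complex.digamma (1 / 4 + t / 2 * I)).re :=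
    integrable_norm_sq_weilMellin_mul_reDigammaQuarter hg
  have hM := integrable_norm_sq_weilMellin_half_line hg
  have hP := integral_norm_sq_weilMellin_half_line hg
  have hθ : (fun t : ℝ ↦ ‖weilMellin g (1 / 2 + t * I)‖ ^ 2 * riemannSiegelThetaDeriv t) =
      fun t : ℝ ↦
        1 / 2 * (‖weilMellin g (1 / 2 + t * I)‖ ^ 2 * (Complex.digamma (1 / 4 + t / 2 * I)).re) -
          Real.log π / 2 * ‖weilMellin g (1 / 2 + t * I)‖ ^ 2 := by
    funext t
    rw [riemannSiegelThetaDeriv]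
    ring
  rw [hθ, integral_sub (hMD.const_mul _) (hM.const_mul _), integral_const_mul, integral_const_mul,
    hP]
  unfold weilArchTerm weilNorm2Sq
  rw [weilArchIntegral_weilConv_weilReflect hg, weilConv_weilReflect_apply_zero]
  rw [show (1 / (2 * π) : ℂ) * (((∫ t : ℝ, ‖weilMellin g (1 / 2 + t * I)‖ ^ 2 *
      (Complex.digamma (1 / 4 + t / 2 * I)).re) : ℝ) : ℂ) -
      (((∫ t : ℝ, ‖g t‖ ^ 2) : ℝ) : ℂ) * (Real.log π : ℂ) =
      (((1 / (2 * π)) * (∫ t : ℝ, ‖weilMellin g (1 / 2 + t * I)‖ ^ 2 *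
        (Complex.digamma (1 / 4 + t / 2 * I)).re) - (∫ t : ℝ, ‖g t‖ ^ 2) * Real.log π : ℝ) : ℂ) by
    push_cast; ring, Complex.ofReal_re]
  exact stub_densityForm_arch_alg _ _

/-! ## The registered stub -/

/-- **stub_densityForm — Weil's quadratic functional in spectral density form.** For a Weil test
`g` supported in `[-a, a]`,
`Re W(g ⋆ g̃) = P(g) + (1/π)(∫ |ĝ(½+it)|² θ'(t) dt − Σ_{log m < 2a} Λ(m) m^{-1/2} ∫ |ĝ(½+it)|² cos(t log m) dt)`,
`P = weilPoleForm`, `θ' = riemannSiegelThetaDeriv` (Yoshida 1992 (2.1) / Bombieri 2000 Thm 2 for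
`k = g ⋆ g̃`, on the critical line). Proof: `Re Q = P + Q₀` (`weilQuadratic_re_eq_weilPoleForm_add`),
`Q₀ = Re(−prime(k) + arch(k))` (`weilMarkovQuadratic_eq_re`), `stub_densityForm_arch`,
`stub_densityForm_prime`. [folklore] -/
theorem stub_densityForm :
    ∀ (g : ℝ → ℂ) (a : ℝ), Literature.NumberTheory.LFunctions.IsWeilTest g → tsupport g ⊆ Set.Icc (-a) a →
      (Literature.NumberTheory.LFunctions.weilQuadratic g).re =
        Literature.NumberTheory.LFunctions.weilPoleForm g + 1 / Real.pi *
          ((∫ t : ℝ, ‖Literature.NumberTheory.LFunctions.weilMellin g (1 / 2 + t * Complex.I)‖ ^ 2 *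
              Literature.NumberTheory.LFunctions.riemannSiegelThetaDeriv t) -
            ∑ m ∈ Literature.NumberTheory.LFunctions.weilPrimeIndex a,
              (ArithmeticFunction.vonMangoldt m : ℝ) / Real.sqrt m *
                ∫ t : ℝ, ‖Literature.NumberTheory.LFunctions.weilMellin g (1 / 2 + t * Complex.I)‖ ^ 2 *
                  Real.cos (t * Real.log m)) := by
  intro g a hg hsupp
  rw [weilQuadratic_re_eq_weilPoleForm_add, weilMarkovQuadratic_eq_re hg, stub_densityForm_arch hg,
    stub_densityForm_prime hg hsupp]
  ring

end Summit.RiemannHypothesis.RiemannHypothesis.Theorems.SpectralTraceWindowStep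

end
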